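import Literature.NumberTheory.LFunctions.SmoothedExplicitFormulaKadiri
import Literature.NumberTheory.LFunctions.KadiriPairPositivity
import Literature.NumberTheory.LFunctions.KadiriStechkinFarZeros
import Literature.NumberTheory.LFunctions.KadiriFarZeroTail
import Literature.NumberTheory.LFunctions.FordZetaZeroRecipSqSum
import HarnessLib

/-!
# Kadiri's lower bound for the sum over the zeros (Acta Arith. 117 (2005), §4.1: Props. 4.2, 4.4 ⇒ Props. 2.5–2.7)

Topic `Literature/NumberTheory/LFunctions`. Everything in this file is PROVED (no named fact; one
abbreviating definition, `KadiriZeroSum.pairVal`, the symmetrised pair). In Kadiri's method the zeros enter the explicit formula (tree: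
`SmoothedEF.re_fordK_eq_kadiri`) at `s = σ + it`, `t = kγ₀`, through the twisted sum

  `Z(s) = Σ_ρ m(ρ) D(s − ρ)`,  `D(z) = Re F(z) − κ Re F(z + δ)`,  `F` the Laplace transform of
  the test function `f = ηh(η·)` (`kadiriTest θ η`),

with multiplicities `m(ρ)`. Following §4.1 ("en nous inspirant de l'idée de Stechkin") the sum is
symmetrised by the involution `ρ ↦ 1 − ρ̄` (`m(1−ρ̄) = m(ρ)`): `Z(s) = ½ Σ_ρ m(ρ)[D(s−ρ) + D(s−1+ρ̄)]`,
and each symmetrised term is bounded below: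

* zeros with `|γ − t| < t₀` have (hypothesis, from the known region and the numerical
  verification of RH in the application) `1 − σ ≤ β ≤ σ`, and the pair is `≥ 0` by Prop. 4.2
  (`KadiriPair.pair_nonneg`, given its boundary inequality `hB`);
* zeros with `|γ − t| ≥ t₀`: by Lemma 3.2 the pair is `ηg₁ · S₄ + (four H-terms)`, `S₄ ≥ 0` by the
  Stechkin mechanism (`KadiriStechkin.fourTerm_nonneg_of_ratio_ge`, given its numerical condition),
  and `|H(x, y)| ≤ M(x/η)η²/y² ≤ M* η²/y²` (`x ≥ σ − 1`), so the pair is `≥ −2(1+κ)M*η²/(γ−t)²`;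
  the resulting tail is controlled by `KadiriTail.summable_far_and_tsum_le`;
* at `t = γ₀` the pair of the zero `ρ₀ = β₀ + iγ₀` under examination is kept:
  `m(ρ₀)[D(σ−β₀) + D(σ−1+β₀)] ≥ D(σ−β₀) + D(σ−1+β₀)` (the pair being `≥ 0`, `m(ρ₀) ≥ 1`).

Result (`KadiriZeroSum.lower_bound_kept`, and `KadiriZeroSum.lower_bound` without kept zero):

  `Z(σ + it) ≥ [D(σ−β₀) + D(σ−1+β₀)]_{kept} − (1+κ) M* η² · 3B(t, t₀)`.

## References

* H. Kadiri, *Une région explicite sans zéros pour la fonction ζ de Riemann*, Acta Arith. 117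
  (2005) = arXiv:math/0401238, §2.4–2.5, §4.1 (Props. 4.2, 4.4, 4.6), (3.10)–(3.11). (`Kadiri2005`)
* M. J. Mossinghoff, T. S. Trudgian, J. Number Theory 157 (2015) = arXiv:1410.3926, §4.3 (`C₃`).
  (`MossinghoffTrudgian2015`)
-/

noncomputable section

open Complex Real MeasureTheory Set
open scoped ComplexConjugate

namespace Literature.NumberTheory.LFunctions

namespace KadiriZeroSum

open FordL33 NicolasJExplicit

variable {θ η : ℝ}

/-! ## Coordinates of `s − ρ` and `s − (1 − ρ̄)` -/

/-- `σ + it − ρ = (σ − β) + i(t − γ)`. [folklore] -/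
theorem sub_coe_eq (σ t : ℝ) (ρ : ℂ) :
    (σ : ℂ) + t * I - ρ = (((σ - ρ.re : ℝ)) : ℂ) + ((t - ρ.im : ℝ) : ℂ) * I := by
  apply Complex.ext <;> simp

/-- `σ + it − (1 − ρ̄) = (σ − 1 + β) + i(t − γ)`. [folklore] -/
theorem sub_refl_eq (σ t : ℝ) (ρ : Zeros) :
    (σ : ℂ) + t * I - ((FordL33.refl ρ : Zeros) : ℂ) = (((σ - 1 + (ρ : ℂ).re : ℝ)) : ℂ) + ((t - (ρ : ℂ).im : ℝ) : ℂ) * I := by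
  apply Complex.ext
  · simp [FordL33.refl]; ring
  · simp [FordL33.refl]

/-- `(σ−β)(σ−1+β) ≥ −(1−σ)` for `0 ≤ β ≤ 1`, `σ ≤ 1`. [folklore] -/
theorem prod_ge {σ β : ℝ} (hβ0 : 0 ≤ β) (hβ1 : β ≤ 1) (hσ1 : σ ≤ 1) :
    -(1 - σ) ≤ (σ - β) * (σ - 1 + β) := by nlinarith

/-! ## The remainder `H(x, y) = Re F(x+iy) − ηg₁x/(x²+y²)` on `x ≥ σ − 1`, `|y| ≥ t₀` -/

/-- `|H(x, y)| ≤ M* η²/y²` when `M(x/η) ≤ M*` and `y ≠ 0`. [cite: Kadiri2005, Lemma 3.2] -/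
theorem abs_H_le (hθ : 0 < θ) (hθ' : θ < π / 2) (hη : 0 < η) {x y Mst : ℝ} (hy : y ≠ 0)
    (hM : mtyM θ (x / η) ≤ Mst) :
    |(fordLaplace (kadiriTest θ η) ((x : ℂ) + y * I)).re - η * fordSmoothW0 θ * x / (x ^ 2 + y ^ 2)| ≤
      Mst * η ^ 2 / y ^ 2 := by
  set z : ℂ := (x : ℂ) + y * I with hz
  have hz0 : z ≠ 0 := fun e ↦ by have := congrArg Complex.im e; simp [hz] at this; exact hy this
  have hn : ‖z‖ ^ 2 = x ^ 2 + y ^ 2 := by rw [Complex.sq_norm, Complex.normSq_apply]; simp [hz]; ring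
  have hzre : z.re = x := by simp [hz]
  have h := KadiriTest.abs_re_fordLaplace_sub_le hθ hθ' hη hz0
  rw [hzre, hn] at h
  refine h.trans ?_
  have hy2 : 0 < y ^ 2 := by positivity
  have hM0 : 0 ≤ mtyM θ (x / η) := KadiriTest.mtyM_nonneg hθ hθ' _
  calc mtyM θ (x / η) * η ^ 2 / (x ^ 2 + y ^ 2) ≤ mtyM θ (x / η) * η ^ 2 / y ^ 2 :=
        div_le_div_of_nonneg_left (by positivity) hy2 (by nlinarith)
    _ ≤ Mst * η ^ 2 / y ^ 2 := by gcongr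

/-- **Lower bound for a far pair** ((3.11) and the proof of Prop. 4.4): for `0 ≤ β ≤ 1`,
`|y| ≥ t₀ ≥ 1`, under the Stechkin condition at `(p₀, t₀) = (−(1−σ), t₀)` and `M(x/η) ≤ M*` for
`x ≥ σ − 1`,
`[F̃(σ−β,y) + F̃(σ−1+β,y)] − κ[F̃(σ+δ−β,y) + F̃(σ+δ−1+β,y)] ≥ −2(1+κ) M* η²/y²`.
[cite: Kadiri2005, Prop. 4.4] -/
theorem far_pair_ge (hθ : 0 < θ) (hθ' : θ < π / 2) (hη : 0 < η) {σ δ κ t₀ Mst β y : ℝ}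
    (hσ : 1 / 2 < σ) (hσ1 : σ ≤ 1) (hδ : 0 ≤ δ) (hδσ : 2 * (1 - σ) ≤ δ) (hκ : 0 ≤ κ) (ht₀ : 1 ≤ t₀)
    (hβ0 : 0 ≤ β) (hβ1 : β ≤ 1) (hy : t₀ ≤ |y|)
    (hA : κ * (2 * σ - 1 + 2 * δ) ≤ 2 * σ - 1)
    (hSt : κ * (2 * σ - 1 + 2 * δ) * (-(1 - σ) + (2 * σ - 1) * δ + δ ^ 2 + t₀ ^ 2) ≤
      (2 * σ - 1) * (-(1 - σ) + t₀ ^ 2))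
    (hM : ∀ x : ℝ, σ - 1 ≤ x → mtyM θ (x / η) ≤ Mst) :
    -(2 * (1 + κ) * Mst * η ^ 2 / y ^ 2) ≤
      ((fordLaplace (kadiriTest θ η) (((σ - β : ℝ) : ℂ) + y * I)).re +
          (fordLaplace (kadiriTest θ η) (((σ - 1 + β : ℝ) : ℂ) + y * I)).re) -
        κ * ((fordLaplace (kadiriTest θ η) (((σ + δ - β : ℝ) : ℂ) + y * I)).re +
          (fordLaplace (kadiriTest θ η) (((σ + δ - 1 + β : ℝ) : ℂ) + y * I)).re) := by
  have hg0 : 0 < fordSmoothW0 θ := fordSmoothW0_pos hθ hθ'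
  have hy0 : y ≠ 0 := fun h ↦ by rw [h, abs_zero] at hy; linarith
  have hy2 : 0 < y ^ 2 := by positivity
  set x₁ : ℝ := σ - β with hx₁
  set x₂ : ℝ := σ - 1 + β with hx₂
  set E : ℝ := Mst * η ^ 2 / y ^ 2 with hE
  -- the four `H`-bounds
  have b1 := (abs_le.1 (abs_H_le hθ hθ' hη (x := x₁) hy0 (hM x₁ (by rw [hx₁]; linarith)))).1
  have b2 := (abs_le.1 (abs_H_le hθ hθ' hη (x := x₂) hy0 (hM x₂ (by rw [hx₂]; linarith)))).1
  have b3 := (abs_le.1 (abs_H_le hθ hθ' hη (x := x₁ + δ) hy0 (hM (x₁ + δ) (by rw [hx₁]; linarith)))).2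
  have b4 := (abs_le.1 (abs_H_le hθ hθ' hη (x := x₂ + δ) hy0 (hM (x₂ + δ) (by rw [hx₂]; linarith)))).2
  rw [← hE] at b1 b2 b3 b4
  -- the Stechkin main term
  have ha : x₁ + x₂ = 2 * σ - 1 := by rw [hx₁, hx₂]; ring
  have hA' : κ * (x₁ + x₂ + 2 * δ) ≤ x₁ + x₂ := by rw [ha]; exact hA
  have hSt' : κ * (x₁ + x₂ + 2 * δ) * (-(1 - σ) + (x₁ + x₂) * δ + δ ^ 2 + t₀ ^ 2) ≤
      (x₁ + x₂) * (-(1 - σ) + t₀ ^ 2) := by rw [ha]; exact hSt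
  have hp0 : 0 < -(1 - σ) + t₀ ^ 2 := by nlinarith
  have hS := KadiriStechkin.fourTerm_nonneg_of_ratio_ge (x₁ := x₁) (x₂ := x₂) (δ := δ) (κ := κ)
    (y := y) (y₀ := t₀) (p₀ := -(1 - σ)) (by rw [ha]; linarith) (by rw [hx₁]; linarith)
    (by rw [hx₂]; linarith) hδ hκ (by linarith) hy
    (by rw [hx₁, hx₂]; exact prod_ge hβ0 hβ1 hσ1) hp0 hA' hSt'
  simp only [KadiriStechkin.re_inv_eq] at hS
  have hmain : 0 ≤ η * fordSmoothW0 θ * (x₁ / (x₁ ^ 2 + y ^ 2) + x₂ / (x₂ ^ 2 + y ^ 2) -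
      κ * ((x₁ + δ) / ((x₁ + δ) ^ 2 + y ^ 2) + (x₂ + δ) / ((x₂ + δ) ^ 2 + y ^ 2))) :=
    mul_nonneg (by positivity) hS
  -- rewrite the four `F̃` in terms of main terms and `H`
  have e1 : ((σ + δ - β : ℝ) : ℂ) = (((x₁ + δ : ℝ)) : ℂ) := by rw [hx₁]; push_cast; ring
  have e2 : ((σ + δ - 1 + β : ℝ) : ℂ) = (((x₂ + δ : ℝ)) : ℂ) := by rw [hx₂]; push_cast; ring
  have hxcast₁ : (((σ - β : ℝ)) : ℂ) = (x₁ : ℂ) := by rw [hx₁]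
  have hxcast₂ : (((σ - 1 + β : ℝ)) : ℂ) = (x₂ : ℂ) := by rw [hx₂]
  rw [e1, e2, hxcast₁, hxcast₂]
  -- name the four values and the four main terms
  set F₁ := (fordLaplace (kadiriTest θ η) ((x₁ : ℂ) + y * I)).re with hF₁
  set F₂ := (fordLaplace (kadiriTest θ η) ((x₂ : ℂ) + y * I)).re with hF₂
  set F₃ := (fordLaplace (kadiriTest θ η) (((x₁ + δ : ℝ) : ℂ) + y * I)).re with hF₃
  set F₄ := (fordLaplace (kadiriTest θ η) (((x₂ + δ : ℝ) : ℂ) + y * I)).re with hF₄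
  have key : (F₁ + F₂) - κ * (F₃ + F₄)
      = η * fordSmoothW0 θ * (x₁ / (x₁ ^ 2 + y ^ 2) + x₂ / (x₂ ^ 2 + y ^ 2) -
          κ * ((x₁ + δ) / ((x₁ + δ) ^ 2 + y ^ 2) + (x₂ + δ) / ((x₂ + δ) ^ 2 + y ^ 2)))
        + ((F₁ - η * fordSmoothW0 θ * x₁ / (x₁ ^ 2 + y ^ 2))
          + (F₂ - η * fordSmoothW0 θ * x₂ / (x₂ ^ 2 + y ^ 2))
          - κ * ((F₃ - η * fordSmoothW0 θ * (x₁ + δ) / ((x₁ + δ) ^ 2 + y ^ 2))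
            + (F₄ - η * fordSmoothW0 θ * (x₂ + δ) / ((x₂ + δ) ^ 2 + y ^ 2)))) := by
    ring
  rw [key]
  have hk3 : κ * ((F₃ - η * fordSmoothW0 θ * (x₁ + δ) / ((x₁ + δ) ^ 2 + y ^ 2))
      + (F₄ - η * fordSmoothW0 θ * (x₂ + δ) / ((x₂ + δ) ^ 2 + y ^ 2))) ≤ κ * (2 * E) := by
    refine mul_le_mul_of_nonneg_left ?_ hκ
    linarith
  have hEκ : 2 * (1 + κ) * Mst * η ^ 2 / y ^ 2 = 2 * E + κ * (2 * E) := by rw [hE]; ring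
  rw [hEκ]
  linarith

/-! ## The pair attached to a zero -/

/-- **Kadiri's symmetrised pair** at the point `σ + it` for a zero `β + iγ`:
`[F̃(σ−β, t−γ) + F̃(σ−1+β, t−γ)] − κ[F̃(σ+δ−β, t−γ) + F̃(σ+δ−1+β, t−γ)]`
(`= D(s − ρ) + D(s − 1 + ρ̄)`, `D(z) = F̃(z) − κF̃(z+δ)`), for the test function `f = ηh(η·)`.
[cite: Kadiri2005, §2.4 (D), Prop. 2.6] -/
def pairVal (θ η σ δ κ t β γ : ℝ) : ℝ :=
  ((fordLaplace (kadiriTest θ η) (((σ - β : ℝ) : ℂ) + ((t - γ : ℝ) : ℂ) * I)).re +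
      (fordLaplace (kadiriTest θ η) (((σ - 1 + β : ℝ) : ℂ) + ((t - γ : ℝ) : ℂ) * I)).re) -
    κ * ((fordLaplace (kadiriTest θ η) (((σ + δ - β : ℝ) : ℂ) + ((t - γ : ℝ) : ℂ) * I)).re +
      (fordLaplace (kadiriTest θ η) (((σ + δ - 1 + β : ℝ) : ℂ) + ((t - γ : ℝ) : ℂ) * I)).re)

/-- The pair is symmetric under `β ↦ 1 − β` (the reflection `ρ ↦ 1 − ρ̄` exchanges its two halves).
[folklore] -/
theorem pairVal_one_sub (θ η σ δ κ t β γ : ℝ) :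
    pairVal θ η σ δ κ t (1 - β) γ = pairVal θ η σ δ κ t β γ := by
  unfold pairVal
  have e1 : (σ - (1 - β) : ℝ) = σ - 1 + β := by ring
  have e2 : (σ - 1 + (1 - β) : ℝ) = σ - β := by ring
  have e3 : (σ + δ - (1 - β) : ℝ) = σ + δ - 1 + β := by ring
  have e4 : (σ + δ - 1 + (1 - β) : ℝ) = σ + δ - β := by ring
  simp only [e1, e2, e3, e4]
  ring

/-- Near zeros: the pair is `≥ 0` when `1 − σ ≤ β ≤ σ` (Prop. 4.2, `KadiriPair.pair_nonneg`).
[cite: Kadiri2005, Prop. 4.2] -/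
theorem pairVal_nonneg (hθ : 0 < θ) (hθ' : θ < π / 2) (hη : 0 < η) {σ δ κ t β γ : ℝ}
    (hσ : 1 / 2 < σ) (hδ : 0 ≤ δ) (hκ : 0 ≤ κ)
    (hB : ∀ y : ℝ, κ * ((fordLaplace (kadiriTest θ η) ((δ : ℂ) + y * I)).re +
        (fordLaplace (kadiriTest θ η) (((2 * σ - 1 + δ : ℝ) : ℂ) + y * I)).re) ≤
      (fordLaplace (kadiriTest θ η) (((0 : ℝ) : ℂ) + y * I)).re +
        (fordLaplace (kadiriTest θ η) (((2 * σ - 1 : ℝ) : ℂ) + y * I)).re)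
    (hβ : β ∈ Icc (1 - σ) σ) : 0 ≤ pairVal θ η σ δ κ t β γ := by
  have hT := KadiriTest.isSmoothedEFTest hθ hθ' hη
  have hdec := KadiriPair.decay_kadiriTest hθ hθ' hη (X := 2 * σ - 1 + δ) (by linarith)
  exact KadiriPair.pair_nonneg (KadiriTest.continuous hθ hθ') hT.x₀_nonneg
    (fun u hu ↦ KadiriTest.eq_zero hθ hθ' hη hu) hσ hδ hκ hdec hB hβ _

/-- Far zeros: the pair is `≥ −2(1+κ)M*η²/(t−γ)²` (`far_pair_ge`). [cite: Kadiri2005, Prop. 4.4] -/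
theorem pairVal_far_ge (hθ : 0 < θ) (hθ' : θ < π / 2) (hη : 0 < η) {σ δ κ t₀ Mst β t γ : ℝ}
    (hσ : 1 / 2 < σ) (hσ1 : σ ≤ 1) (hδ : 0 ≤ δ) (hδσ : 2 * (1 - σ) ≤ δ) (hκ : 0 ≤ κ) (ht₀ : 1 ≤ t₀)
    (hβ0 : 0 ≤ β) (hβ1 : β ≤ 1) (hy : t₀ ≤ |t - γ|)
    (hA : κ * (2 * σ - 1 + 2 * δ) ≤ 2 * σ - 1)
    (hSt : κ * (2 * σ - 1 + 2 * δ) * (-(1 - σ) + (2 * σ - 1) * δ + δ ^ 2 + t₀ ^ 2) ≤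
      (2 * σ - 1) * (-(1 - σ) + t₀ ^ 2))
    (hM : ∀ x : ℝ, σ - 1 ≤ x → mtyM θ (x / η) ≤ Mst) :
    -(2 * (1 + κ) * Mst * η ^ 2 / (t - γ) ^ 2) ≤ pairVal θ η σ δ κ t β γ :=
  far_pair_ge hθ hθ' hη hσ hσ1 hδ hδσ hκ ht₀ hβ0 hβ1 hy hA hSt hM

/-! ## The symmetrised zero sum and its lower bound -/

/-- **Kadiri's lower bound for the zero sum, with one kept zero** (§4.1, Props. 4.2 + 4.4, the
bookkeeping of (3.10)–(3.11)). At `s = σ + it` (`1/2 < σ ≤ 1`, `t ≥ 0`, `ζ ≠ 0` at `s` and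
`s + δ`), for the test function `f = ηh(η·)`: if every zero with `|γ − t| < t₀` has
`1 − σ ≤ β ≤ σ`, the boundary inequality of Prop. 4.2 and the Stechkin condition at `(−(1−σ), t₀)`
hold, `2(1−σ) ≤ δ`, and `M(x/η) ≤ M*` for `x ≥ σ − 1`, then for any zero `ρ₀ = β₀ + iγ₀` with
`|γ₀ − t| < t₀` and `β₀ > 1/2`,
`Σ_ρ m(ρ)[Re F(s−ρ) − κ Re F(s+δ−ρ)] ≥ pairVal(β₀, γ₀) − (1+κ) M* η² · 3B(t, t₀)`.
[cite: Kadiri2005, Props. 4.2, 4.4, (3.10)] -/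
theorem lower_bound_kept (hθ : 0 < θ) (hθ' : θ < π / 2) (hη : 0 < η) {σ δ κ t t₀ Mst : ℝ}
    (hσ : 1 / 2 < σ) (hσ1 : σ ≤ 1) (ht : 0 ≤ t) (hδ : 0 ≤ δ) (hδσ : 2 * (1 - σ) ≤ δ) (hκ : 0 ≤ κ)
    (ht₀ : 4 ≤ t₀)
    (hζ : riemannZeta ((σ : ℂ) + t * I) ≠ 0) (hζ' : riemannZeta (((σ + δ : ℝ) : ℂ) + t * I) ≠ 0)
    (hnear : ∀ ρ : Zeros, |(ρ : ℂ).im - t| < t₀ → 1 - σ ≤ (ρ : ℂ).re ∧ (ρ : ℂ).re ≤ σ)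
    (hB : ∀ y : ℝ, κ * ((fordLaplace (kadiriTest θ η) ((δ : ℂ) + y * I)).re +
        (fordLaplace (kadiriTest θ η) (((2 * σ - 1 + δ : ℝ) : ℂ) + y * I)).re) ≤
      (fordLaplace (kadiriTest θ η) (((0 : ℝ) : ℂ) + y * I)).re +
        (fordLaplace (kadiriTest θ η) (((2 * σ - 1 : ℝ) : ℂ) + y * I)).re)
    (hA : κ * (2 * σ - 1 + 2 * δ) ≤ 2 * σ - 1)
    (hSt : κ * (2 * σ - 1 + 2 * δ) * (-(1 - σ) + (2 * σ - 1) * δ + δ ^ 2 + t₀ ^ 2) ≤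
      (2 * σ - 1) * (-(1 - σ) + t₀ ^ 2))
    (hM : ∀ x : ℝ, σ - 1 ≤ x → mtyM θ (x / η) ≤ Mst)
    (ρ₀ : Zeros) (hρ₀ : |(ρ₀ : ℂ).im - t| < t₀) (hβ₀ : 1 / 2 < (ρ₀ : ℂ).re) :
    pairVal θ η σ δ κ t (ρ₀ : ℂ).re (ρ₀ : ℂ).im - (1 + κ) * Mst * η ^ 2 * (3 * KadiriTail.tailBound t t₀) ≤
      ∑' ρ : Zeros, (riemannZetaZeroOrder (ρ : ℂ) : ℝ) *
        ((fordLaplace (kadiriTest θ η) ((σ : ℂ) + t * I - ρ)).re -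
          κ * (fordLaplace (kadiriTest θ η) (((σ + δ : ℝ) : ℂ) + t * I - ρ)).re) := by
  classical
  have hT := KadiriTest.isSmoothedEFTest hθ hθ' hη
  set s : ℂ := (σ : ℂ) + t * I with hs
  set s' : ℂ := ((σ + δ : ℝ) : ℂ) + t * I with hs'
  -- the summand and its summability
  set g : Zeros → ℝ := fun ρ ↦ (riemannZetaZeroOrder (ρ : ℂ) : ℝ) *
    ((fordLaplace (kadiriTest θ η) (s - ρ)).re - κ * (fordLaplace (kadiriTest θ η) (s' - ρ)).re) with hg
  have hsum1 := SmoothedEF.summable_zeroOrder_mul_re_fordLaplace hT (s := s) (by simp [hs]; linarith) hζ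
  have hsum2 := SmoothedEF.summable_zeroOrder_mul_re_fordLaplace hT (s := s') (by simp [hs']; linarith) hζ'
  have hsum_g : Summable g := by
    refine (hsum1.sub (hsum2.mul_left κ)).congr fun ρ ↦ ?_
    simp only [hg]
    ring
  -- symmetrisation by `ρ ↦ 1 − ρ̄`
  have hsum_gr : Summable (g ∘ FordL33.refl) := (Equiv.summable_iff FordL33.reflEquiv).2 hsum_g
  have htsum_gr : ∑' ρ, (g ∘ FordL33.refl) ρ = ∑' ρ, g ρ := Equiv.tsum_eq FordL33.reflEquiv g
  set P : Zeros → ℝ := fun ρ ↦ g ρ + (g ∘ FordL33.refl) ρ with hP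
  have hsum_P : Summable P := hsum_g.add hsum_gr
  have htsum_P : ∑' ρ, P ρ = 2 * ∑' ρ, g ρ := by
    rw [hP, hsum_g.tsum_add hsum_gr, htsum_gr]
    ring
  -- `P ρ = m(ρ) · pairVal(β, γ)`
  have hP_eq : ∀ ρ : Zeros, P ρ = (riemannZetaZeroOrder (ρ : ℂ) : ℝ) * pairVal θ η σ δ κ t (ρ : ℂ).re (ρ : ℂ).im := by
    intro ρ
    have him : ((FordL33.refl ρ : Zeros) : ℂ).im = (ρ : ℂ).im := by simp [FordL33.refl]
    simp only [hP, hg, Function.comp_apply, FordL33.order_refl, hs, hs', sub_coe_eq, pairVal,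
      FordL33.refl_re, him]
    have e4 : σ - (1 - (ρ : ℂ).re) = σ - 1 + (ρ : ℂ).re := by ring
    have e5 : σ + δ - (1 - (ρ : ℂ).re) = σ + δ - 1 + (ρ : ℂ).re := by ring
    simp only [e4, e5]
    ring
  -- basic facts on zeros
  have hm0 : ∀ ρ : Zeros, (0 : ℝ) ≤ riemannZetaZeroOrder (ρ : ℂ) := fun ρ ↦ (FordL33.order_pos ρ).le
  have hm1 : ∀ ρ : Zeros, (1 : ℝ) ≤ riemannZetaZeroOrder (ρ : ℂ) := fun ρ ↦ by
    exact_mod_cast ZetaZeros.riemannZetaNontrivialZeros.one_le_order ρ.2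
  have hβ01 : ∀ ρ : Zeros, 0 ≤ (ρ : ℂ).re ∧ (ρ : ℂ).re ≤ 1 := fun ρ ↦
    ⟨(ZetaZeros.riemannZetaNontrivialZeros.re_pos ρ.2).le, (ZetaZeros.riemannZetaNontrivialZeros.re_lt_one ρ.2).le⟩
  -- pointwise lower bounds for the pair
  have hpair_near : ∀ ρ : Zeros, |(ρ : ℂ).im - t| < t₀ → 0 ≤ pairVal θ η σ δ κ t (ρ : ℂ).re (ρ : ℂ).im :=
    fun ρ hρ ↦ pairVal_nonneg hθ hθ' hη hσ hδ hκ hB (hnear ρ hρ)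
  have hpair_far : ∀ ρ : Zeros, t₀ ≤ |(ρ : ℂ).im - t| →
      -(2 * (1 + κ) * Mst * η ^ 2 / (t - (ρ : ℂ).im) ^ 2) ≤ pairVal θ η σ δ κ t (ρ : ℂ).re (ρ : ℂ).im := by
    intro ρ hρ
    have hy : t₀ ≤ |t - (ρ : ℂ).im| := by rwa [abs_sub_comm]
    exact pairVal_far_ge hθ hθ' hη hσ hσ1 hδ hδσ hκ (by linarith) (hβ01 ρ).1 (hβ01 ρ).2 hy hA hSt hM
  -- the minorant `L`
  set K₀ : ℝ := pairVal θ η σ δ κ t (ρ₀ : ℂ).re (ρ₀ : ℂ).im with hK₀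
  set C : ℝ := 2 * (1 + κ) * Mst * η ^ 2 with hC
  have hMst0 : 0 ≤ Mst := (KadiriTest.mtyM_nonneg hθ hθ' _).trans (hM σ (by linarith))
  have hC0 : 0 ≤ C := by positivity
  set far : Zeros → ℝ := fun ρ ↦ if t₀ ≤ |(ρ : ℂ).im - t| then
      (riemannZetaZeroOrder (ρ : ℂ) : ℝ) / ((ρ : ℂ).im - t) ^ 2 else 0 with hfar
  set ind : Zeros → ℝ := fun ρ ↦ if ρ = ρ₀ ∨ ρ = FordL33.refl ρ₀ then 1 else 0 with hind
  set L : Zeros → ℝ := fun ρ ↦ K₀ * ind ρ - C * far ρ with hL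
  obtain ⟨hfar_sum, hfar_le⟩ := KadiriTail.summable_far_and_tsum_le ht ht₀
  -- the kept pair
  have hne : ρ₀ ≠ FordL33.refl ρ₀ := fun e ↦ by
    have := congrArg (fun ρ : Zeros ↦ (ρ : ℂ).re) e
    simp only [FordL33.refl_re] at this
    linarith
  have hK₀0 : 0 ≤ K₀ := hpair_near ρ₀ hρ₀
  have hind_zero : ∀ ρ ∉ ({ρ₀, FordL33.refl ρ₀} : Finset Zeros), ind ρ = 0 := by
    intro ρ hρ
    simp only [Finset.mem_insert, Finset.mem_singleton, not_or] at hρ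
    simp [hind, hρ.1, hρ.2]
  have hind_sum : Summable ind := summable_of_ne_finset_zero hind_zero
  have hind_tsum : ∑' ρ, ind ρ = 2 := by
    rw [tsum_eq_sum hind_zero, Finset.sum_pair hne]
    simp [hind]
    norm_num
  have hL_sum : Summable L := (hind_sum.mul_left K₀).sub (hfar_sum.mul_left C)
  have hL_tsum : ∑' ρ, L ρ = 2 * K₀ - C * ∑' ρ, far ρ := by
    rw [hL, (hind_sum.mul_left K₀).tsum_sub (hfar_sum.mul_left C), tsum_mul_left, tsum_mul_left,
      hind_tsum]
    ring
  -- pointwise `L ≤ P`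
  have hLP : ∀ ρ : Zeros, L ρ ≤ P ρ := by
    intro ρ
    rw [hP_eq ρ]
    simp only [hL, hind, hfar]
    by_cases hk : ρ = ρ₀ ∨ ρ = FordL33.refl ρ₀
    · -- kept: the pair equals `K₀ ≥ 0` and the multiplicity is `≥ 1`
      have hval : pairVal θ η σ δ κ t (ρ : ℂ).re (ρ : ℂ).im = K₀ := by
        rcases hk with h | h
        · rw [h]
        · rw [h, hK₀]
          have hre : ((FordL33.refl ρ₀ : Zeros) : ℂ).re = 1 - (ρ₀ : ℂ).re := FordL33.refl_re ρ₀
          have him : ((FordL33.refl ρ₀ : Zeros) : ℂ).im = (ρ₀ : ℂ).im := by simp [FordL33.refl]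
          rw [hre, him, pairVal_one_sub]
      have hnear' : |(ρ : ℂ).im - t| < t₀ := by
        rcases hk with h | h
        · rw [h]; exact hρ₀
        · rw [h]
          have him : ((FordL33.refl ρ₀ : Zeros) : ℂ).im = (ρ₀ : ℂ).im := by simp [FordL33.refl]
          rw [him]; exact hρ₀
      rw [if_pos hk, if_neg (not_le.2 hnear'), hval]
      have := hm1 ρ
      nlinarith [hK₀0]
    · rw [if_neg hk]
      by_cases hfarρ : t₀ ≤ |(ρ : ℂ).im - t|
      · rw [if_pos hfarρ]
        have h1 := hpair_far ρ hfarρ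
        have hy0 : ((ρ : ℂ).im - t) ^ 2 = (t - (ρ : ℂ).im) ^ 2 := by ring
        have hne0 : t - (ρ : ℂ).im ≠ 0 := fun e ↦ by
          rw [show (ρ : ℂ).im - t = -(t - (ρ : ℂ).im) by ring, e, neg_zero, abs_zero] at hfarρ
          linarith
        have hy2 : 0 < (t - (ρ : ℂ).im) ^ 2 := by positivity
        rw [hy0]
        have h2 := mul_le_mul_of_nonneg_left h1 (hm0 ρ)
        have e : K₀ * 0 - C * ((riemannZetaZeroOrder (ρ : ℂ) : ℝ) / (t - (ρ : ℂ).im) ^ 2) =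
            (riemannZetaZeroOrder (ρ : ℂ) : ℝ) * -(2 * (1 + κ) * Mst * η ^ 2 / (t - (ρ : ℂ).im) ^ 2) := by
          rw [hC]; field_simp; ring
        rw [e]
        exact h2
      · rw [if_neg hfarρ]
        simp only [mul_zero, sub_zero]
        exact mul_nonneg (hm0 ρ) (hpair_near ρ (not_le.1 hfarρ))
  -- conclude
  have key : ∑' ρ, L ρ ≤ ∑' ρ, P ρ := Summable.tsum_le_tsum hLP hL_sum hsum_P
  rw [hL_tsum, htsum_P] at key
  have hfar' : C * ∑' ρ, far ρ ≤ C * (3 * KadiriTail.tailBound t t₀) :=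
    mul_le_mul_of_nonneg_left hfar_le hC0
  have : K₀ - (1 + κ) * Mst * η ^ 2 * (3 * KadiriTail.tailBound t t₀) ≤ ∑' ρ, g ρ := by
    rw [hC] at hfar'
    nlinarith
  simpa [hg] using this

/-- **Kadiri's lower bound for the zero sum, no kept zero** (the points `σ + ikγ₀`, `k ≠ 1`, and
`k = 0`): under the hypotheses of `lower_bound_kept` (without a designated zero),
`Σ_ρ m(ρ)[Re F(s−ρ) − κ Re F(s+δ−ρ)] ≥ −(1+κ) M* η² · 3B(t, t₀)`.
[cite: Kadiri2005, Props. 4.2, 4.4] -/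
theorem lower_bound (hθ : 0 < θ) (hθ' : θ < π / 2) (hη : 0 < η) {σ δ κ t t₀ Mst : ℝ}
    (hσ : 1 / 2 < σ) (hσ1 : σ ≤ 1) (ht : 0 ≤ t) (hδ : 0 ≤ δ) (hδσ : 2 * (1 - σ) ≤ δ) (hκ : 0 ≤ κ)
    (ht₀ : 4 ≤ t₀)
    (hζ : riemannZeta ((σ : ℂ) + t * I) ≠ 0) (hζ' : riemannZeta (((σ + δ : ℝ) : ℂ) + t * I) ≠ 0)
    (hnear : ∀ ρ : Zeros, |(ρ : ℂ).im - t| < t₀ → 1 - σ ≤ (ρ : ℂ).re ∧ (ρ : ℂ).re ≤ σ)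
    (hB : ∀ y : ℝ, κ * ((fordLaplace (kadiriTest θ η) ((δ : ℂ) + y * I)).re +
        (fordLaplace (kadiriTest θ η) (((2 * σ - 1 + δ : ℝ) : ℂ) + y * I)).re) ≤
      (fordLaplace (kadiriTest θ η) (((0 : ℝ) : ℂ) + y * I)).re +
        (fordLaplace (kadiriTest θ η) (((2 * σ - 1 : ℝ) : ℂ) + y * I)).re)
    (hA : κ * (2 * σ - 1 + 2 * δ) ≤ 2 * σ - 1)
    (hSt : κ * (2 * σ - 1 + 2 * δ) * (-(1 - σ) + (2 * σ - 1) * δ + δ ^ 2 + t₀ ^ 2) ≤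
      (2 * σ - 1) * (-(1 - σ) + t₀ ^ 2))
    (hM : ∀ x : ℝ, σ - 1 ≤ x → mtyM θ (x / η) ≤ Mst) :
    -((1 + κ) * Mst * η ^ 2 * (3 * KadiriTail.tailBound t t₀)) ≤
      ∑' ρ : Zeros, (riemannZetaZeroOrder (ρ : ℂ) : ℝ) *
        ((fordLaplace (kadiriTest θ η) ((σ : ℂ) + t * I - ρ)).re -
          κ * (fordLaplace (kadiriTest θ η) (((σ + δ : ℝ) : ℂ) + t * I - ρ)).re) := by
  classical
  have hT := KadiriTest.isSmoothedEFTest hθ hθ' hη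
  set s : ℂ := (σ : ℂ) + t * I with hs
  set s' : ℂ := ((σ + δ : ℝ) : ℂ) + t * I with hs'
  set g : Zeros → ℝ := fun ρ ↦ (riemannZetaZeroOrder (ρ : ℂ) : ℝ) *
    ((fordLaplace (kadiriTest θ η) (s - ρ)).re - κ * (fordLaplace (kadiriTest θ η) (s' - ρ)).re) with hg
  have hsum1 := SmoothedEF.summable_zeroOrder_mul_re_fordLaplace hT (s := s) (by simp [hs]; linarith) hζ
  have hsum2 := SmoothedEF.summable_zeroOrder_mul_re_fordLaplace hT (s := s') (by simp [hs']; linarith) hζ'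
  have hsum_g : Summable g := by
    refine (hsum1.sub (hsum2.mul_left κ)).congr fun ρ ↦ ?_
    simp only [hg]
    ring
  have hsum_gr : Summable (g ∘ FordL33.refl) := (Equiv.summable_iff FordL33.reflEquiv).2 hsum_g
  have htsum_gr : ∑' ρ, (g ∘ FordL33.refl) ρ = ∑' ρ, g ρ := Equiv.tsum_eq FordL33.reflEquiv g
  set P : Zeros → ℝ := fun ρ ↦ g ρ + (g ∘ FordL33.refl) ρ with hP
  have hsum_P : Summable P := hsum_g.add hsum_gr
  have htsum_P : ∑' ρ, P ρ = 2 * ∑' ρ, g ρ := by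
    rw [hP, hsum_g.tsum_add hsum_gr, htsum_gr]
    ring
  have hP_eq : ∀ ρ : Zeros, P ρ = (riemannZetaZeroOrder (ρ : ℂ) : ℝ) * pairVal θ η σ δ κ t (ρ : ℂ).re (ρ : ℂ).im := by
    intro ρ
    have him : ((FordL33.refl ρ : Zeros) : ℂ).im = (ρ : ℂ).im := by simp [FordL33.refl]
    simp only [hP, hg, Function.comp_apply, FordL33.order_refl, hs, hs', sub_coe_eq, pairVal,
      FordL33.refl_re, him]
    have e4 : σ - (1 - (ρ : ℂ).re) = σ - 1 + (ρ : ℂ).re := by ring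
    have e5 : σ + δ - (1 - (ρ : ℂ).re) = σ + δ - 1 + (ρ : ℂ).re := by ring
    simp only [e4, e5]
    ring
  have hm0 : ∀ ρ : Zeros, (0 : ℝ) ≤ riemannZetaZeroOrder (ρ : ℂ) := fun ρ ↦ (FordL33.order_pos ρ).le
  have hβ01 : ∀ ρ : Zeros, 0 ≤ (ρ : ℂ).re ∧ (ρ : ℂ).re ≤ 1 := fun ρ ↦
    ⟨(ZetaZeros.riemannZetaNontrivialZeros.re_pos ρ.2).le, (ZetaZeros.riemannZetaNontrivialZeros.re_lt_one ρ.2).le⟩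
  have hpair_near : ∀ ρ : Zeros, |(ρ : ℂ).im - t| < t₀ → 0 ≤ pairVal θ η σ δ κ t (ρ : ℂ).re (ρ : ℂ).im :=
    fun ρ hρ ↦ pairVal_nonneg hθ hθ' hη hσ hδ hκ hB (hnear ρ hρ)
  have hpair_far : ∀ ρ : Zeros, t₀ ≤ |(ρ : ℂ).im - t| →
      -(2 * (1 + κ) * Mst * η ^ 2 / (t - (ρ : ℂ).im) ^ 2) ≤ pairVal θ η σ δ κ t (ρ : ℂ).re (ρ : ℂ).im := by
    intro ρ hρ
    have hy : t₀ ≤ |t - (ρ : ℂ).im| := by rwa [abs_sub_comm]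
    exact pairVal_far_ge hθ hθ' hη hσ hσ1 hδ hδσ hκ (by linarith) (hβ01 ρ).1 (hβ01 ρ).2 hy hA hSt hM
  set C : ℝ := 2 * (1 + κ) * Mst * η ^ 2 with hC
  have hMst0 : 0 ≤ Mst := (KadiriTest.mtyM_nonneg hθ hθ' _).trans (hM σ (by linarith))
  have hC0 : 0 ≤ C := by positivity
  set far : Zeros → ℝ := fun ρ ↦ if t₀ ≤ |(ρ : ℂ).im - t| then
      (riemannZetaZeroOrder (ρ : ℂ) : ℝ) / ((ρ : ℂ).im - t) ^ 2 else 0 with hfar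
  set L : Zeros → ℝ := fun ρ ↦ -(C * far ρ) with hL
  obtain ⟨hfar_sum, hfar_le⟩ := KadiriTail.summable_far_and_tsum_le ht ht₀
  have hL_sum : Summable L := (hfar_sum.mul_left C).neg
  have hL_tsum : ∑' ρ, L ρ = -(C * ∑' ρ, far ρ) := by
    rw [hL, tsum_neg, tsum_mul_left]
  have hLP : ∀ ρ : Zeros, L ρ ≤ P ρ := by
    intro ρ
    rw [hP_eq ρ]
    simp only [hL, hfar]
    by_cases hfarρ : t₀ ≤ |(ρ : ℂ).im - t|
    · rw [if_pos hfarρ]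
      have h1 := hpair_far ρ hfarρ
      have hy0 : ((ρ : ℂ).im - t) ^ 2 = (t - (ρ : ℂ).im) ^ 2 := by ring
      have hne0 : t - (ρ : ℂ).im ≠ 0 := fun e ↦ by
        rw [show (ρ : ℂ).im - t = -(t - (ρ : ℂ).im) by ring, e, neg_zero, abs_zero] at hfarρ
        linarith
      have hy2 : 0 < (t - (ρ : ℂ).im) ^ 2 := by positivity
      rw [hy0]
      have h2 := mul_le_mul_of_nonneg_left h1 (hm0 ρ)
      have e : -(C * ((riemannZetaZeroOrder (ρ : ℂ) : ℝ) / (t - (ρ : ℂ).im) ^ 2)) =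
          (riemannZetaZeroOrder (ρ : ℂ) : ℝ) * -(2 * (1 + κ) * Mst * η ^ 2 / (t - (ρ : ℂ).im) ^ 2) := by
        rw [hC]; field_simp
      rw [e]
      exact h2
    · rw [if_neg hfarρ]
      simp only [mul_zero, neg_zero]
      exact mul_nonneg (hm0 ρ) (hpair_near ρ (not_le.1 hfarρ))
  have key : ∑' ρ, L ρ ≤ ∑' ρ, P ρ := Summable.tsum_le_tsum hLP hL_sum hsum_P
  rw [hL_tsum, htsum_P] at key
  have hfar' : C * ∑' ρ, far ρ ≤ C * (3 * KadiriTail.tailBound t t₀) :=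
    mul_le_mul_of_nonneg_left hfar_le hC0
  have : -((1 + κ) * Mst * η ^ 2 * (3 * KadiriTail.tailBound t t₀)) ≤ ∑' ρ, g ρ := by
    rw [hC] at hfar'
    nlinarith
  simpa [hg] using this

end KadiriZeroSum

end Literature.NumberTheory.LFunctions
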